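import Mathlib
import Summits.Ventures.FusionMHD.Models.CerfonFreidbergIterLikeQHalfResDefs
import HarnessLib

/-!
# Ventures/FusionMHD — Models/CerfonFreidbergIterLikeQHalfResPanels19.lean: KERNEL CHECK of the resistive-register certificates of panel(s) 31 (of 32)
# at `ψ_N = 1/2` of THE Cerfon–Freidberg ITER-like instance

HONEST FRAMING (LADDER-GRIDFUSION three columns; CF rung; rider «D_R at ψ_N = 1/2»).  One `decide +kernel` (≈ 60–90 s): for each listed panel the obligation
`CFIterLike.QHalfRes.ResCert.ok` (`Models/CerfonFreidbergIterLikeQHalfResDefs.lean`) — the Taylor-model run of `progR = progM ++ block3R` over ★ #117's parameter box is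
ACCEPTED and the kernel's two panel-integral enclosures (`g_AG`, `g_W` along the approximant) lie inside the claimed integers (compiled `#eval` of the same functions, slack
one unit of `2⁻⁶⁰`; float truth inside every panel, `genqm/truthR.json`).  MODELLED: analytic Cerfon–Freidberg family; nothing about a device or stability.
No `native_decide`.  Typer/prover: gridfusion-model-7 (g7), 2026-08-28.  Citations: Zheng 2015 §3.2 (3.42) [Zheng2015];
Mahboubi–Melquiond–Sibut-Pinote 2016 §3.2 Lemma 3 [MahboubiMelquiondSibutpinote2016].
-/

namespace Summit.Ventures.FusionMHD.Models.CFIterLike.QHalfRes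

/-- Resistive-register certificate data of panel(s) 31. [instance data] -/
def resCert19 : List ResCert := [
  { j := 31, cand1 := [751733570500371546112, -293152696643552608256, 9439644766439675527168, -3766488534561026211840, 60739063778312800174080, -18207879650546552930304, 191927363517266903695360, 58699499666296333664256, -139505931704969069592576, 19646256011213652287815680, -1224372521979652143168094208, -27230143296477336291462086656, 1215056757604186513427784531968],
    cand2 := [602656637529941999616, -140689816309451325440, 4529472563981535150080, -1758031699621984862208, 28491602704537713901568, -13995241354800316547072, 152085568014686177198080, -76408674537163498455040, 503389123335376435412992, -382512985356725043331072, 509932722913651463399931904, -1218695344382706804699693056, -792715480485767567435406245888],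
    deg := 12, e1 := 45, e2 := 44, glo := 4581939285979208, ghi := 4581939891404251, wlo := 165475127022153931, whi := 165475146950118316 }]

/-- **KERNEL CHECK** of the two resistive registers on panel(s) 31. -/
theorem resCert19_ok : CFIterLike.QHalfRes.resCert19.all ResCert.ok = true := by
  decide +kernel

end Summit.Ventures.FusionMHD.Models.CFIterLike.QHalfRes
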